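import Literature.AlgebraicGeometry.Frobenioids.GeometricDivisorPrimes
import Literature.AlgebraicGeometry.Frobenioids.GeometricFrobenioidNonDilating
import Literature.AlgebraicGeometry.Frobenioids.DirectSumPerfFactorial
import Literature.AlgebraicGeometry.Frobenioids.MonoidTransport
import Literature.AlgebraicGeometry.Frobenioids.PerfectionDivisorial
import HarnessLib

/-!
# Frobenioids I, Example 6.1: "one verifies immediately that `Φ(L)` is perf-factorial" — PROOF, for every
# `GeometricDivisorData` (the monoid of Cartier effective divisors supported in `D_L`)

Mochizuki, *The geometry of Frobenioids I: the general theory*, Kyushu J. Math. **62** (2008) 293–400,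
Example 6.1, kurims p. 109 ll. 39–41: "moreover, one verifies immediately that `Φ(L)` is perf-factorial, that
there is a natural bijection `Prime(Φ(L)) → D_L`, and that the supports of elements of `Φ(L)` are precisely the
finite subsets of `D_L`"; Def. 2.4 (i) p. 47 (perf-factorial). [cite: MochizukiFrdI2008, Ex. 6.1 p.109]

PROOF-ONLY (theorems, no `def`; cell abc-iut, seat abc-iut-L6-t10 gen 3, holder of the [FrdI] §6 sub-DAG).
For the interface `GeometricDivisorData` (seat abc-iut-L1-t3, v4: `Φ(L) ⊆ ℤ_{≥0}[D_L]` a submonoid with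
`qCartier` — every prime divisor has a Cartier multiple — and `sub_mem` — saturation) the printed claim is
PROVED, `GeometricDivisorData.isPerfFactorial_phi`, by assembling Def. 2.4 (i) (`IsPerfFactorial.of_cond`):
(a) `Φ(L)` is divisorial (seat abc-iut-L6-t10 gen 2, `isDivisorial_phi_of_sub_mem`);
(b) for each prime `𝔭 ↔ s ∈ D_L` (gen 2's `support_eq_singleton_of_isPrimary` / `single_precsim_single`), the
    monoid `Φ(L)_𝔭` is `{i · s ∈ Φ(L)} = m_s ℤ_{≥0} · s ≅ ℤ_{≥0}` with `m_s` the least Cartier multiple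
    (saturation makes `{i | i · s ∈ Φ(L)}` closed under subtraction) — `isMonoprime_submonoid_phi`;
(c)(d) only involve `Φ(L)^pf`, and **`Φ(L)^pf = ℤ_{≥0}[D_L]^pf`** (`perfection_map_subtype_bijective`: every
    `D ∈ ℤ_{≥0}[D_L]` has a multiple `N · D ∈ Φ(L)`, gen 2's `prod_smul_mem`), so they are transported
    (`Factorization.Cond.of_mulEquiv`, seat abc-iut-L1-t2/L1-d2) from the free monoid
    `ℤ_{≥0}[D_L] ≅ ⊕_{D_L} ℤ_{≥0}` (`multiplicativeFinsuppEquivDirectSum`-shaped equivalence built in the proof,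
    seat abc-iut-L1-d2's `DirectSum.isPerfFactorial`).
Consequence: `geomDivisorFunctor_isPerfFactorial` — the binder `hΦ` of gen 2's `geomRlfFunctor_isMonoidOn` and of
seat abc-iut-w5-d137's `geomFrobenioid_rlf_isFrobenioid` (THE realification `C_{K̃/K}^rlf` is a Frobenioid) is
available for every `Γ` (instantiated in the companion `GeometricFrobenioidRealificationUnconditional.lean`).

Standard axioms only. Nothing here bears on [IUTchIII] Cor. 3.12 or asserts anything about abc.
-/

noncomputable section

namespace Literature.AlgebraicGeometry.Frobenioids

open CategoryTheory Opposite Function Literature.AnabelianGeometry.EtaleTheta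

/-! ### `ℤ_{≥0}[I] ≅ ⊕_I ℤ_{≥0}` and its perf-factoriality -/

section Free

variable (ι : Type)

/-- The free commutative monoid `ℤ_{≥0}[I]` (finitely supported `ℕ`-valued functions, multiplicatively) is the
direct sum `⊕_I ℤ_{≥0}` of seat abc-iut-L1-d2's `DirectSumMonoids`: a multiplicative equivalence exists.
[cite: MochizukiFrdI2008, Ex. 6.1 p.109] -/
theorem nonempty_multiplicative_finsupp_mulEquiv_directSum :
    Nonempty (Multiplicative (ι →₀ ℕ) ≃* directSum (fun _ : ι => Multiplicative ℕ)) := by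
  classical
  let φ : Multiplicative (ι →₀ ℕ) →* directSum (fun _ : ι => Multiplicative ℕ) :=
    { toFun := fun f => ⟨fun i => Multiplicative.ofAdd (Multiplicative.toAdd f i),
        (Multiplicative.toAdd f).support.finite_toSet.subset fun i hi => by
          rw [Finset.mem_coe, Finsupp.mem_support_iff]
          intro h0
          exact hi (show Multiplicative.ofAdd (Multiplicative.toAdd f i) = 1 by rw [h0]; rfl)⟩
      map_one' := Subtype.ext (funext fun i => rfl)
      map_mul' := fun f g => Subtype.ext (funext fun i => rfl) }
  refine ⟨MulEquiv.ofBijective φ ⟨fun f g h => ?_, fun g => ?_⟩⟩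
  · apply Multiplicative.toAdd.injective
    ext i
    exact Multiplicative.ofAdd.injective (congrFun (congrArg Subtype.val h) i)
  · have hfin : (Function.support fun i => Multiplicative.toAdd ((g : ∀ i, (fun _ : ι => Multiplicative ℕ) i) i)).Finite :=
      (DirectSum.finite_dsupp g).subset fun i hi h1 => hi (by
        change Multiplicative.toAdd ((g : ∀ i, (fun _ : ι => Multiplicative ℕ) i) i) = 0
        rw [h1]; rfl)
    refine ⟨Multiplicative.ofAdd (Finsupp.ofSupportFinite _ hfin), Subtype.ext (funext fun i => ?_)⟩
    change Multiplicative.ofAdd (Multiplicative.toAdd (Multiplicative.ofAdd (Finsupp.ofSupportFinite _ hfin)) i) = _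
    rw [toAdd_ofAdd, Finsupp.ofSupportFinite_coe, ofAdd_toAdd]

/-- **`ℤ_{≥0}[I]` is perf-factorial** — a direct sum of copies of the monoprime `ℤ_{≥0}` (seat abc-iut-L1-d2's
`DirectSum.isPerfFactorial`), transported along `ℤ_{≥0}[I] ≅ ⊕_I ℤ_{≥0}` (Def. 2.4 (i) is invariant under
isomorphisms: `IsDivisorial.of_mulEquiv`, `IsMonoprime.of_mulEquiv`, `Factorization.Cond.of_mulEquiv`).
[cite: MochizukiFrdI2008, Def. 2.4 (i) p.47] -/
theorem isPerfFactorial_multiplicative_finsupp : IsPerfFactorial (Multiplicative (ι →₀ ℕ)) := by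
  classical
  obtain ⟨e'⟩ := nonempty_multiplicative_finsupp_mulEquiv_directSum ι
  have h : IsPerfFactorial (directSum (fun _ : ι => Multiplicative ℕ)) :=
    DirectSum.isPerfFactorial fun _ => IsMonoprime.ofZ ⟨⟨MulEquiv.refl _⟩⟩
  let e := e'.symm
  refine IsPerfFactorial.of_cond (h.isDivisorial.of_mulEquiv e) (fun 𝔭' => ?_)
    (Factorization.Cond.of_mulEquiv (Perfection.congr e) h.cond)
  exact (h.isMonoprime (Primes.congr e.symm 𝔭')).of_mulEquiv
    (Primes.submonoidCongr e (Primes.congr e.symm 𝔭') 𝔭' (Primes.congr_apply_congr_symm e 𝔭'))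

end Free

namespace GeometricDivisorData

variable {K : Type} [Field K] {Kt : Type} [Field Kt] [Algebra K Kt] (Γ : GeometricDivisorData K Kt)
  (X : FinSubextCat K Kt)

/-! ### (c)(d): `Φ(L)^pf = ℤ_{≥0}[D_L]^pf` -/

/-- The inclusion `Φ(L) ⊆ ℤ_{≥0}[D_L]` induces a BIJECTION `Φ(L)^pf → ℤ_{≥0}[D_L]^pf`: injective because the
inclusion is (`Perfection.map_injective`), surjective because every `D ∈ ℤ_{≥0}[D_L]` has a Cartier multiple
`N · D ∈ Φ(L)` (`qCartier`, gen 2's `prod_smul_mem`) and `D^{1/k} = (N · D)^{1/(kN)}`.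
[cite: MochizukiFrdI2008, Ex. 6.1 p.109] -/
theorem perfection_map_subtype_bijective :
    Bijective (Perfection.map (AddMonoidHom.toMultiplicative (Γ.Phi X).subtype)) := by
  classical
  refine ⟨Perfection.map_injective _ fun a b h => ?_, fun y => ?_⟩
  · exact Multiplicative.toAdd.injective (Subtype.ext (congrArg Multiplicative.toAdd h))
  · obtain ⟨⟨d, k⟩, rfl⟩ := Perfection.mk_surjective y
    choose n hn0 hn using Γ.qCartier X
    set T := (Multiplicative.toAdd d).support
    have hN0 : 0 < ∏ t ∈ T, n t := Finset.prod_pos fun t _ => hn0 t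
    have hmem : (∏ t ∈ T, n t) • Multiplicative.toAdd d ∈ Γ.Phi X :=
      Γ.prod_smul_mem X T n hn _ subset_rfl
    refine ⟨Perfection.mk (Multiplicative.ofAdd ⟨_, hmem⟩) (k * ⟨_, hN0⟩), ?_⟩
    change Perfection.mk (Multiplicative.ofAdd ((∏ t ∈ T, n t) • Multiplicative.toAdd d)) (k * ⟨_, hN0⟩) =
      Perfection.mk d k
    rw [ofAdd_nsmul, ofAdd_toAdd]
    exact Perfection.mk_pow_mul d k ⟨_, hN0⟩

/-! ### (b): `Φ(L)_𝔭 ≅ ℤ_{≥0}` -/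

open scoped Classical in
/-- The multiples of a prime divisor `s` lying in `Φ(L)` are exactly the multiples of the LEAST Cartier multiple
`m · s` (saturation: `{i | i · s ∈ Φ(L)}` is closed under subtraction). [cite: MochizukiFrdI2008, Ex. 6.1 p.109] -/
theorem single_mem_phi_iff_dvd (s : Γ.primeDiv X) (h : ∃ m, 0 < m ∧ Finsupp.single s m ∈ Γ.Phi X) (i : ℕ) :
    Finsupp.single s i ∈ Γ.Phi X ↔ Nat.find h ∣ i := by
  classical
  obtain ⟨hm0, hm⟩ := Nat.find_spec h
  set m := Nat.find h with hmdef
  constructor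
  · intro hi
    -- `i = m q + r`, `r < m`, and `r · s = i · s − (m q) · s ∈ Φ(L)` by saturation
    have hq : Finsupp.single s (m * (i / m)) ∈ Γ.Phi X := by
      rw [mul_comm, ← smul_eq_mul, ← Finsupp.smul_single]
      exact AddSubmonoid.nsmul_mem _ hm _
    have hr : Finsupp.single s (i % m) ∈ Γ.Phi X := by
      have hsub := Γ.sub_mem X _ _ hi hq (Finsupp.le_def.mpr fun t => by
        by_cases hts : s = t
        · subst hts
          simp only [Finsupp.single_eq_same]
          exact Nat.mul_div_le i m
        · simp [hts])
      rwa [← Finsupp.single_tsub, show i - m * (i / m) = i % m from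
        Nat.sub_eq_of_eq_add (by rw [Nat.add_comm, Nat.div_add_mod])] at hsub
    by_contra hdvd
    have hr0 : 0 < i % m := Nat.pos_of_ne_zero fun h0 => hdvd (Nat.dvd_of_mod_eq_zero h0)
    exact Nat.find_min h (Nat.mod_lt i hm0) ⟨hr0, hr⟩
  · rintro ⟨q, rfl⟩
    rw [mul_comm, ← smul_eq_mul, ← Finsupp.smul_single]
    exact AddSubmonoid.nsmul_mem _ hm _

/-- Membership in the monoid `Φ(L)_𝔭` generated by the primary elements of the class of `a · s`: exactly the
elements of `Φ(L)` supported in `{s}`. [cite: MochizukiFrdI2008, Ex. 6.1 p.109] -/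
theorem mem_submonoid_iff_support_subset {a : Γ.Phi X} (ha : IsPrimary (Multiplicative.ofAdd a))
    {s : Γ.primeDiv X} (hs : (a : Γ.primeDiv X →₀ ℕ).support = {s}) (x : Multiplicative (Γ.Phi X)) :
    x ∈ Primes.submonoid (Quotient.mk (primarySetoid (Multiplicative (Γ.Phi X))) ⟨Multiplicative.ofAdd a, ha⟩) ↔
      ((Multiplicative.toAdd x : Γ.Phi X) : Γ.primeDiv X →₀ ℕ).support ⊆ {s} := by
  classical
  set 𝔭 : Primes (Multiplicative (Γ.Phi X)) := Quotient.mk (primarySetoid _) ⟨Multiplicative.ofAdd a, ha⟩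
  -- the carrier of `𝔭`: elements supported exactly at `s`
  have hcar : ∀ y : Multiplicative (Γ.Phi X), y ∈ 𝔭.carrier ↔
      ((Multiplicative.toAdd y : Γ.Phi X) : Γ.primeDiv X →₀ ℕ).support = {s} := by
    intro y
    constructor
    · rintro ⟨hy, hcls⟩
      have hy' : IsPrimary (Multiplicative.ofAdd (Multiplicative.toAdd y)) := hy
      obtain ⟨t, ht⟩ := Γ.support_eq_singleton_of_isPrimary X hy'
      have hrel : Precsim (Multiplicative.ofAdd (Multiplicative.toAdd y)) (Multiplicative.ofAdd a) :=
        Quotient.exact hcls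
      have hsub := Γ.support_subset_of_precsim X hrel
      rw [ht, hs, Finset.singleton_subset_iff, Finset.mem_singleton] at hsub
      rw [← hsub]
      exact ht
    · intro hy
      have hy' : IsPrimary (Multiplicative.ofAdd (Multiplicative.toAdd y)) :=
        Γ.isPrimary_of_support_eq_singleton X hy
      refine ⟨hy', Quotient.sound ?_⟩
      change Precsim (Multiplicative.ofAdd (Multiplicative.toAdd y)) (Multiplicative.ofAdd a)
      have hya : ((Multiplicative.toAdd y : Γ.Phi X) : Γ.primeDiv X →₀ ℕ) =
          Finsupp.single s (((Multiplicative.toAdd y : Γ.Phi X) : Γ.primeDiv X →₀ ℕ) s) :=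
        Finsupp.support_subset_singleton.mp (by rw [hy])
      have haa : (a : Γ.primeDiv X →₀ ℕ) = Finsupp.single s ((a : Γ.primeDiv X →₀ ℕ) s) :=
        Finsupp.support_subset_singleton.mp (by rw [hs])
      have has : 0 < (a : Γ.primeDiv X →₀ ℕ) s :=
        Nat.pos_of_ne_zero (Finsupp.mem_support_iff.mp (by rw [hs]; exact Finset.mem_singleton_self s))
      have hmemy : Finsupp.single s (((Multiplicative.toAdd y : Γ.Phi X) : Γ.primeDiv X →₀ ℕ) s) ∈ Γ.Phi X :=
        hya ▸ (Multiplicative.toAdd y).2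
      have hmema : Finsupp.single s ((a : Γ.primeDiv X →₀ ℕ) s) ∈ Γ.Phi X := haa ▸ a.2
      rw [show Multiplicative.toAdd y = ⟨_, hmemy⟩ from Subtype.ext hya, show a = ⟨_, hmema⟩ from Subtype.ext haa]
      exact Γ.single_precsim_single X hmemy hmema has
  constructor
  · intro hx
    induction hx using Submonoid.closure_induction with
    | mem y hy => exact ((hcar y).mp hy).le
    | one => intro t ht; exact absurd ht (by simp)
    | mul y z _ _ hy hz =>
      intro t ht
      have ht' := Finsupp.support_add ht
      rcases Finset.mem_union.mp ht' with h | h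
      · exact hy h
      · exact hz h
  · intro hx
    by_cases h0 : ((Multiplicative.toAdd x : Γ.Phi X) : Γ.primeDiv X →₀ ℕ) = 0
    · have : x = 1 := by
        rw [← ofAdd_toAdd x, show Multiplicative.toAdd x = (0 : Γ.Phi X) from Subtype.ext h0]; rfl
      rw [this]
      exact one_mem _
    · refine Submonoid.subset_closure ((hcar x).mpr ?_)
      refine Finset.Subset.antisymm hx (Finset.singleton_subset_iff.mpr ?_)
      obtain ⟨t, ht⟩ := Finsupp.support_nonempty_iff.mpr h0
      have := hx ht
      rw [Finset.mem_singleton] at this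
      rwa [this] at ht

/-- **(b) of Def. 2.4 (i) for `Φ(L)`: every `Φ(L)_𝔭` is (`ℤ`-)monoprime** — for `𝔭 ↔ s`, `Φ(L)_𝔭 = {i · s ∈ Φ(L)}
`= m ℤ_{≥0} · s ≅ ℤ_{≥0}` with `m` the least Cartier multiple of `s`. [cite: MochizukiFrdI2008, Ex. 6.1 p.109] -/
theorem isMonoprime_submonoid_phi (𝔭 : Primes (Multiplicative (Γ.Phi X))) : IsMonoprime ↥𝔭.submonoid := by
  classical
  induction 𝔭 using Quotient.ind with
  | _ a =>
    obtain ⟨a₀, ha₀⟩ := a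
    have ha' : IsPrimary (Multiplicative.ofAdd (Multiplicative.toAdd a₀)) := ha₀
    obtain ⟨s, hs⟩ := Γ.support_eq_singleton_of_isPrimary X ha'
    set 𝔭 : Primes (Multiplicative (Γ.Phi X)) := Quotient.mk (primarySetoid _) ⟨a₀, ha₀⟩
    have hmem : ∀ x : Multiplicative (Γ.Phi X), x ∈ 𝔭.submonoid ↔
        ((Multiplicative.toAdd x : Γ.Phi X) : Γ.primeDiv X →₀ ℕ).support ⊆ {s} := fun x => by
      exact Γ.mem_submonoid_iff_support_subset X ha' hs x
    have hex : ∃ m, 0 < m ∧ Finsupp.single s m ∈ Γ.Phi X := Γ.qCartier X s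
    set m := Nat.find hex with hmdef
    have hm0 : 0 < m := (Nat.find_spec hex).1
    -- the homomorphism `ℤ_{≥0} → Φ(L)_𝔭`, `k ↦ (k m) · s`
    have hkmem : ∀ k : ℕ, Finsupp.single s (m * k) ∈ Γ.Phi X := fun k =>
      (Γ.single_mem_phi_iff_dvd X s hex _).mpr (dvd_mul_right m k)
    have hksub : ∀ k : ℕ, Multiplicative.ofAdd (⟨_, hkmem k⟩ : Γ.Phi X) ∈ 𝔭.submonoid := fun k => by
      rw [hmem, toAdd_ofAdd]
      exact Finsupp.support_single_subset
    let φ : Multiplicative ℕ →* ↥𝔭.submonoid :=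
      { toFun := fun k => ⟨Multiplicative.ofAdd (⟨_, hkmem (Multiplicative.toAdd k)⟩ : Γ.Phi X), hksub _⟩
        map_one' := Subtype.ext (congrArg Multiplicative.ofAdd (Subtype.ext (by simp)))
        map_mul' := fun k l => Subtype.ext ((congrArg Multiplicative.ofAdd (Subtype.ext (by
            simp [toAdd_mul, mul_add, Finsupp.single_add]))).trans (ofAdd_add _ _)) }
    have hφ : Bijective φ := by
      constructor
      · intro k l h
        have h' : (Finsupp.single s (m * Multiplicative.toAdd k) : Γ.primeDiv X →₀ ℕ) s =
            (Finsupp.single s (m * Multiplicative.toAdd l) : Γ.primeDiv X →₀ ℕ) s :=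
          DFunLike.congr_fun (congrArg Subtype.val (Multiplicative.ofAdd.injective
            (congrArg Subtype.val h))) s
        rw [Finsupp.single_eq_same, Finsupp.single_eq_same] at h'
        exact Multiplicative.toAdd.injective (Nat.eq_of_mul_eq_mul_left hm0 h')
      · rintro ⟨x, hx⟩
        have hx' := (hmem x).mp hx
        set c := ((Multiplicative.toAdd x : Γ.Phi X) : Γ.primeDiv X →₀ ℕ) s
        have hxs : ((Multiplicative.toAdd x : Γ.Phi X) : Γ.primeDiv X →₀ ℕ) = Finsupp.single s c :=
          Finsupp.support_subset_singleton.mp hx'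
        have hc : Finsupp.single s c ∈ Γ.Phi X := hxs ▸ (Multiplicative.toAdd x).2
        obtain ⟨q, hq⟩ := (Γ.single_mem_phi_iff_dvd X s hex c).mp hc
        refine ⟨Multiplicative.ofAdd q, Subtype.ext ?_⟩
        change Multiplicative.ofAdd (⟨Finsupp.single s (m * Multiplicative.toAdd (Multiplicative.ofAdd q)), _⟩ : Γ.Phi X) = x
        rw [← ofAdd_toAdd x]
        exact congrArg Multiplicative.ofAdd (Subtype.ext (by
          change Finsupp.single s (m * Multiplicative.toAdd (Multiplicative.ofAdd q)) =
            ((Multiplicative.toAdd x : Γ.Phi X) : Γ.primeDiv X →₀ ℕ)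
          rw [toAdd_ofAdd, ← hq, ← hxs]))
    exact IsMonoprime.ofZ ⟨⟨(MulEquiv.ofBijective φ hφ).symm⟩⟩

/-! ### `Φ(L)` is perf-factorial -/

/-- **Example 6.1: "one verifies immediately that `Φ(L)` is perf-factorial"** (FrdI p. 109) — PROVED for every
`GeometricDivisorData`: (a) divisorial (`isDivisorial_phi_of_sub_mem`), (b) `Φ(L)_𝔭 ≅ ℤ_{≥0}`
(`isMonoprime_submonoid_phi`), (c)(d) transported from the free monoid `ℤ_{≥0}[D_L]` along
`Φ(L)^pf = ℤ_{≥0}[D_L]^pf` (`perfection_map_subtype_bijective`). [cite: MochizukiFrdI2008, Ex. 6.1 p.109] -/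
theorem isPerfFactorial_phi : IsPerfFactorial (Multiplicative (Γ.Phi X)) :=
  IsPerfFactorial.of_cond (Γ.isDivisorial_phi_of_sub_mem X (Γ.sub_mem X)) (Γ.isMonoprime_submonoid_phi X)
    (Factorization.Cond.of_mulEquiv
      (MulEquiv.ofBijective (Perfection.map (AddMonoidHom.toMultiplicative (Γ.Phi X).subtype))
        (Γ.perfection_map_subtype_bijective X)).symm
      (isPerfFactorial_multiplicative_finsupp (Γ.primeDiv X)).cond)

/-- "`Φ` is a perf-factorial divisorial monoid on `D`" (Ex. 6.1 p. 109 l. 46): the geometric divisor monoid of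
`C_{K̃/K}` has perf-factorial values, in the `Dᵒᵖ`-indexed form. [cite: MochizukiFrdI2008, Ex. 6.1 p.109] -/
theorem geomDivisorFunctor_isPerfFactorial :
    ∀ Y : (FinSubextCat K Kt)ᵒᵖ, IsPerfFactorial ((geomDivisorFunctor Γ).obj Y) :=
  fun Y => Γ.isPerfFactorial_phi Y.unop

end GeometricDivisorData

end Literature.AlgebraicGeometry.Frobenioids

end
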